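import Literature.AnabelianGeometry.AbsoluteAnabelian.MLFGaloisGroups
import Literature.NumberTheory.GaloisRepresentations.DecompositionGroupCommTerminal
import HarnessLib

/-!
# [AbsAnab] Theorem 1.1.1 (i): decomposition groups in `G_F` are commensurably terminal — proof

Mochizuki, *The absolute anabelian geometry of hyperbolic curves* (2004), §1.1, Theorem 1.1.1 (i)
(lit key `paper:url-e8f118cc205e`, p. 6): for a number field `F` and a nonarchimedean prime `𝔭`
of `F̄`, the decomposition group `G_𝔭 ⊆ G_F` is commensurably terminal, `C_{G_F}(G_𝔭) = G_𝔭`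
("a formal consequence of [NSW], Corollary 12.1.3").  Cited by [IUTchI] Example 5.1 (v) (kurims
p. 130: "since `Π_{p₀}` is commensurably terminal in `π₁(†𝒟^⊛)` — cf., e.g., [AbsAnab], Theorem
1.1.1, (i)").

This PROOF-ONLY file discharges the named fact
`Literature.AnabelianGeometry.AbsoluteAnabelian.galoisNF_decomposition_commensurablyTerminal`
(`MLFGaloisGroups.lean`, abc-iut-L4-t4), typed over Mathlib's
`ValuationSubring.decompositionSubgroup` (nontrivial valuation subrings `A ≠ ⊤` of
`F̄ = AlgebraicClosure F` = the nonarchimedean primes of `F̄`):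

* `coe_absIntegers_mem_valuationSubring` — every valuation subring of `F̄` contains the ring
  `\bar ℤ_F = absIntegers (𝓞 F) F` of all algebraic integers;
* `exists_ideal_mem_primesAbove_of_ne_top` — a nontrivial valuation subring `A` cuts out a prime
  `𝔓_A = 𝔪_A ∩ \bar ℤ_F` of `\bar ℤ_F` lying above a finite place `v` of `F`;
* `decompositionGroupNF_eq_decompositionSubgroup` — `G_𝔭` as typed (stabiliser of `A` in
  `Γ_F`) is the stabiliser of `𝔓_A` (trunk dictionary
  `Ideal.decompositionSubgroup_eq_of_valuationSubring_holds`, Serre *Local Fields* I §7);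
* **`galoisNF_decomposition_commensurablyTerminal_holds`** — Thm. 1.1.1 (i), from
  `commensurator_decompositionSubgroup_eq_of_mem_primesAbove` (`DecompositionFieldRigidity.lean`:
  the local–global identification `D_𝔓 = Gal(\bar F_v/F_v)` of the GalRep trunk plus a rigidity
  theorem for the henselian decomposition field — no class field theory, no Chebotarev).

HONEST FRAMING: classical, undisputed algebraic number theory; our kernel check of a refereed
statement; nothing here bears on [IUTchIII] Cor. 3.12.

## References

* S. Mochizuki, *The absolute anabelian geometry of hyperbolic curves* (2004), Thm. 1.1.1 (i).
  [MochizukiAbsAnab2004]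
* J. Neukirch, A. Schmidt, K. Wingberg, *Cohomology of Number Fields* (2nd ed. 2008), Cor. 12.1.3.
  [NeukirchSchmidtWingberg2008]
* J.-P. Serre, *Local Fields*, GTM 67 (1979), Ch. I §7 (decomposition group of a prime of the
  integral closure). [SerreLocalFields1979]
-/

noncomputable section

open scoped NumberField Pointwise
open Field IsDedekindDomain Literature.NumberTheory.GaloisRepresentations

namespace Literature.AnabelianGeometry.AbsoluteAnabelian

variable {F : Type} [Field F] [NumberField F]

omit [NumberField F] in
/-- Every valuation subring `A` of `F̄` contains the algebraic integers `\bar ℤ_F` (they are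
integral over `ℤ ⊆ A`, and a valuation ring is integrally closed in its fraction field `F̄`).
Serre, *Local Fields*, Ch. I §7 / Neukirch, *Algebraic Number Theory*, Ch. II (3.8).
[cite: SerreLocalFields1979, Ch. I §7 Prop. 19–21] -/
theorem coe_absIntegers_mem_valuationSubring (A : ValuationSubring (AlgebraicClosure F))
    (s : absIntegers (𝓞 F) F) : (s : AlgebraicClosure F) ∈ A := by
  have h1 : IsIntegral ℤ (s : AlgebraicClosure F) := isIntegral_trans (R := ℤ) _ s.2
  have h2 : IsIntegral A (s : AlgebraicClosure F) := h1.tower_top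
  obtain ⟨y, hy⟩ := (IsIntegrallyClosed.isIntegral_iff (R := A) (K := AlgebraicClosure F)).mp h2
  rw [← hy]
  exact y.2

/-- **The prime of `\bar ℤ_F` cut out by a nonarchimedean prime of `F̄`.**  For a nontrivial
valuation subring `A ≠ ⊤` of `F̄` there are a finite place `v` of `F` and a prime `𝔓 ∣ v` of
`\bar ℤ_F` with `𝔓 = 𝔪_A ∩ \bar ℤ_F`, i.e. `s ∈ 𝔓 ↔ s` is a non-unit of `A`.  (`𝔓` is the
contraction of the non-units; it is prime, and `𝔓 ∩ 𝓞 F ≠ 0`, for otherwise every element of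
`F̄ = (𝓞 F)⁻¹ \bar ℤ_F` would lie in `A`.)  Serre, *Local Fields*, Ch. I §7; Neukirch, Ch. II §8
(primes of `F̄` ↔ extensions of the valuations of `F`). [cite: SerreLocalFields1979, Ch. I §7 Prop. 19–21] -/
theorem exists_ideal_mem_primesAbove_of_ne_top (A : ValuationSubring (AlgebraicClosure F))
    (hA : A ≠ ⊤) :
    ∃ (v : HeightOneSpectrum (𝓞 F)) (𝔓 : Ideal (absIntegers (𝓞 F) F)), 𝔓 ∈ v.primesAbove ∧
      ∀ s : absIntegers (𝓞 F) F, s ∈ 𝔓 ↔ (s : AlgebraicClosure F) ∈ A.nonunits := by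
  classical
  -- the contraction of the non-units of `A` to `\bar ℤ_F`
  let 𝔓 : Ideal (absIntegers (𝓞 F) F) :=
    { carrier := {s | (s : AlgebraicClosure F) ∈ A.nonunits}
      zero_mem' := by
        change ((0 : absIntegers (𝓞 F) F) : AlgebraicClosure F) ∈ A.nonunits
        rw [ValuationSubring.mem_nonunits_iff, Subalgebra.coe_zero, map_zero]
        exact zero_lt_one
      add_mem' := by
        intro a b ha hb
        have ha' : (a : AlgebraicClosure F) ∈ A.nonunits := ha
        have hb' : (b : AlgebraicClosure F) ∈ A.nonunits := hb
        change ((a + b : absIntegers (𝓞 F) F) : AlgebraicClosure F) ∈ A.nonunits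
        rw [ValuationSubring.mem_nonunits_iff] at ha' hb' ⊢
        rw [Subalgebra.coe_add]
        exact lt_of_le_of_lt (A.valuation.map_add _ _) (max_lt ha' hb')
      smul_mem' := by
        intro c s hs
        have hs' : (s : AlgebraicClosure F) ∈ A.nonunits := hs
        change ((c * s : absIntegers (𝓞 F) F) : AlgebraicClosure F) ∈ A.nonunits
        rw [ValuationSubring.mem_nonunits_iff] at hs' ⊢
        rw [Subalgebra.coe_mul, map_mul]
        have hc : A.valuation (c : AlgebraicClosure F) ≤ 1 :=
          (A.valuation_le_one_iff _).mpr (coe_absIntegers_mem_valuationSubring A c)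
        calc A.valuation (c : AlgebraicClosure F) * A.valuation (s : AlgebraicClosure F)
            ≤ 1 * A.valuation (s : AlgebraicClosure F) := mul_le_mul' hc le_rfl
          _ < 1 := by rwa [one_mul] }
  have h𝔓 : ∀ s : absIntegers (𝓞 F) F, s ∈ 𝔓 ↔ (s : AlgebraicClosure F) ∈ A.nonunits :=
    fun _ => Iff.rfl
  haveI h𝔓prime : 𝔓.IsPrime := Ideal.isPrime_of_mem_iff_mem_nonunits (𝓞 F) A 𝔓 h𝔓
  -- `𝔓 ∩ 𝓞 F ≠ 0`
  have hbot : 𝔓.under (𝓞 F) ≠ ⊥ := by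
    intro hbot
    apply hA
    -- every `x ∈ F̄` lies in `A`
    refine eq_top_iff.mpr fun x _ => ?_
    have hxalg : IsAlgebraic (𝓞 F) x :=
      (IsFractionRing.isAlgebraic_iff (𝓞 F) F (AlgebraicClosure F)).mpr
        (Algebra.IsAlgebraic.isAlgebraic x)
    obtain ⟨r, hr0, hr⟩ := hxalg.exists_integral_multiple
    rw [Algebra.smul_def] at hr
    -- `r ∉ 𝔓`, so `r` is a unit of `A`
    have hrS : (algebraMap (𝓞 F) (absIntegers (𝓞 F) F) r) ∉ 𝔓 := by
      intro hmem
      have : r ∈ 𝔓.under (𝓞 F) := hmem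
      rw [hbot, Ideal.mem_bot] at this
      exact hr0 this
    rw [h𝔓, ValuationSubring.mem_nonunits_iff, not_lt] at hrS
    have hrA : (algebraMap (𝓞 F) (AlgebraicClosure F) r) ∈ A := by
      have := coe_absIntegers_mem_valuationSubring A (algebraMap (𝓞 F) (absIntegers (𝓞 F) F) r)
      exact this
    have hval : A.valuation (algebraMap (𝓞 F) (AlgebraicClosure F) r) = 1 :=
      le_antisymm ((A.valuation_le_one_iff _).mpr hrA) hrS
    have hr0' : algebraMap (𝓞 F) (AlgebraicClosure F) r ≠ 0 := by
      intro h0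
      rw [h0, map_zero] at hval
      exact zero_ne_one hval
    -- `x = (r x) r⁻¹` with `r x ∈ \bar ℤ_F ⊆ A` and `r⁻¹ ∈ A`
    have hrx : algebraMap (𝓞 F) (AlgebraicClosure F) r * x ∈ A :=
      coe_absIntegers_mem_valuationSubring A ⟨_, hr⟩
    have hinv : (algebraMap (𝓞 F) (AlgebraicClosure F) r)⁻¹ ∈ A := by
      rw [← A.valuation_le_one_iff, map_inv₀, hval, inv_one]
    have : x = (algebraMap (𝓞 F) (AlgebraicClosure F) r * x) *
        (algebraMap (𝓞 F) (AlgebraicClosure F) r)⁻¹ := by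
      rw [mul_comm, ← mul_assoc, inv_mul_cancel₀ hr0', one_mul]
    rw [this]
    exact A.mul_mem _ _ hrx hinv
  refine ⟨⟨𝔓.under (𝓞 F), inferInstance, hbot⟩, 𝔓, ⟨h𝔓prime, ⟨rfl⟩⟩, h𝔓⟩

/-- **`G_𝔭` as typed is the stabiliser of the prime `𝔓_A`**: for a valuation subring `A` of `F̄`
and `𝔓 = 𝔪_A ∩ \bar ℤ_F`, the group `decompositionGroupNF F A` (stabiliser of `A` in `Γ_F`,
Mathlib's `ValuationSubring.decompositionSubgroup`) equals `D_𝔓` (the trunk's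
`Ideal.decompositionSubgroup`), by `Ideal.decompositionSubgroup_eq_of_valuationSubring_holds`
(`A = (\bar ℤ_F)_𝔓`).  Serre, *Local Fields*, Ch. I §7 (`D_𝔓`), Ch. II §3 Cor. 4.
[cite: SerreLocalFields1979, Ch. I §7 Prop. 19–21 and Ch. II §3 Cor. 4] -/
theorem decompositionGroupNF_eq_decompositionSubgroup (A : ValuationSubring (AlgebraicClosure F))
    (𝔓 : Ideal (absIntegers (𝓞 F) F))
    (h𝔓 : ∀ s : absIntegers (𝓞 F) F, s ∈ 𝔓 ↔ (s : AlgebraicClosure F) ∈ A.nonunits) :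
    decompositionGroupNF F A = 𝔓.decompositionSubgroup (absoluteGaloisGroup F) := by
  have key := Ideal.decompositionSubgroup_eq_of_valuationSubring_holds (𝓞 F) (K := F)
    (L := AlgebraicClosure F) A (coe_absIntegers_mem_valuationSubring A) 𝔓 h𝔓
  ext σ
  rw [decompositionGroupNF, Subgroup.mem_comap, ← key]
  rfl

/-- **[AbsAnab] Theorem 1.1.1 (i) (discharge of `galoisNF_decomposition_commensurablyTerminal`).**
For a number field `F` and a nonarchimedean prime `𝔭` of `F̄` (a valuation subring `A ≠ ⊤` of
`F̄`), the decomposition group `G_𝔭 ⊆ G_F` is commensurably terminal: `C_{G_F}(G_𝔭) = G_𝔭`.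
Mochizuki (2004), Thm. 1.1.1 (i) p. 6 ("a formal consequence of [NSW], Corollary 12.1.3"); here
OUR proof: `G_𝔭 = D_𝔓` for the prime `𝔓 = 𝔪_A ∩ \bar ℤ_F` above a finite place `v`, and
`C_{Γ_F}(D_𝔓) = D_𝔓` by `commensurator_decompositionSubgroup_eq_of_mem_primesAbove` (rigidity
of the decomposition field, `DecompositionFieldRigidity.lean`).
[cite: MochizukiAbsAnab2004, Thm 1.1.1 (i) p.6] -/
theorem galoisNF_decomposition_commensurablyTerminal_holds :
    galoisNF_decomposition_commensurablyTerminal := by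
  intro F _ _ A hA
  obtain ⟨v, 𝔓, h𝔓v, h𝔓⟩ := exists_ideal_mem_primesAbove_of_ne_top A hA
  rw [decompositionGroupNF_eq_decompositionSubgroup A 𝔓 h𝔓]
  exact commensurator_decompositionSubgroup_eq_of_mem_primesAbove F v h𝔓v

end Literature.AnabelianGeometry.AbsoluteAnabelian
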